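import Summits.Ventures.PackingBounds.ThreePointCert.C6Td11Cert

/-!
# A(6, arccos 1/3) ≤ 34 (three-point bound, degree 11, kernel-checked): kernel validation of Gram block R2 (chunks 1–4 of 19)

Framing: lottery ticket; floor = certified bounds/negative ranges. Venture `PackingBounds` (cell
`pub-packcert`), three-point SDP family. Integer data of a feasible point of the Bachoc–Vallentin
semidefinite program (n = 6, s = 1/3, degree d = 11, symmetric
sums of squares), derived by `pub-packcert-sdp/code/cert2lean.py` from the exact rational
certificate `sdp-n6-d11-s1-3-sym-lppolish-v1.json` of the cell (two independent exact verifiers + referee), in the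
units of the kernel checker `ThreePointCert.Check` (soundness `ThreePointCert.Sound`). Generated
file: plain lists of integers / monomials.
-/

namespace Summit.Ventures.PackingBounds.ThreePointCert.C6Td11

open Literature.Geometry.DiscreteGeometry Literature.Geometry.DiscreteGeometry.PolyCert PolyCert.SPoly

set_option maxHeartbeats 0 in
/-- Block `R2`: rows from 0 (43 rows) of `zᵀ(LLᵀ)z` added to `[]` give `dR2c1` (kernel). -/
theorem okR2_1 : chunkOK C6Td11.gR2 0 43 [] C6Td11.dR2c1 = true := by
  decide +kernel

set_option maxHeartbeats 0 in
/-- Block `R2`: rows from 43 (19 rows) of `zᵀ(LLᵀ)z` added to `dR2c1` give `dR2c2` (kernel). -/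
theorem okR2_2 : chunkOK C6Td11.gR2 43 19 C6Td11.dR2c1 C6Td11.dR2c2 = true := by
  decide +kernel

set_option maxHeartbeats 0 in
/-- Block `R2`: rows from 62 (15 rows) of `zᵀ(LLᵀ)z` added to `dR2c2` give `dR2c3` (kernel). -/
theorem okR2_3 : chunkOK C6Td11.gR2 62 15 C6Td11.dR2c2 C6Td11.dR2c3 = true := by
  decide +kernel

set_option maxHeartbeats 0 in
/-- Block `R2`: rows from 77 (13 rows) of `zᵀ(LLᵀ)z` added to `dR2c3` give `dR2c4` (kernel). -/
theorem okR2_4 : chunkOK C6Td11.gR2 77 13 C6Td11.dR2c3 C6Td11.dR2c4 = true := by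
  decide +kernel

end Summit.Ventures.PackingBounds.ThreePointCert.C6Td11
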